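import Summits.ValiantsHypothesis.ValiantsHypothesis.Theorems.NewtonFramesTwoProductsFrameRungTwoTrinomialWords

/-!
# Crux `TwoProducts` (stmt-5906), line `FrameRungTwo`: the rigidity lemma for trinomial frames without parallelogram coincidences

Second of four files.  `step_three` / `matched_three`: at a cross-cancelling vertex of `Π f + Π g` (one product on each of two
dissociated frames with `≤ 3` letters per coordinate... in fact any number: the letter bound is not used here), if neither frame
has a parallelogram coincidence at its key-top corners, then every one-letter demotion of EITHER frame that is key-above the
vertex is a one-letter demotion of the OTHER frame, with the same gap and the same coefficient ratio.  Induction down the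
floor's lexicographic key; the `≥ 2`-letter branch dies either by dissociation (injective matching, `transfer_letters`) or by
`no_double_match` (two gaps matched into one coordinate).
Honest scope: a `t`-variant (trinomial frames without parallelogram coincidences, `k ≤ 2`) of ONE stub of a rung strictly
below the crux `TwoProducts`; nothing here bears on the crux in general or on `VP ≠ VNP`. [ours; setting KPTT arXiv:1308.2286 §2, §5]
-/

set_option linter.dupNamespace false

namespace Summit.ValiantsHypothesis.ValiantsHypothesis.Theorems.NewtonFramesTwoProducts.FrameRungTwoTrinomial

open MvPolynomial
open scoped BigOperators Classical
open Summit.ValiantsHypothesis.Theorems.DissociatedFixedK (lexKey lexKey_injective lexTop lexTop_mem lexKey_le_lexTop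
  stub_topTupleCount count_arith)
open Summit.ValiantsHypothesis.ValiantsHypothesis.Theorems.DissociatedFixedK.Negative (emb emb_injective)
open Summit.ValiantsHypothesis.ValiantsHypothesis.Theorems.NewtonFramesTwoProducts.FrameRungTwoBinomial
  (emb_add emb_sum lexKey_sum apply_le_of_lexKey_le lexKey_lt_of_apply_lt lexKey_sum_lt_sum lexKey_sum_le_sum
   eq_T_of_not_mem_filter ne_T_of_mem_filter lexKey_sum_lt_T lexKey_sum_le_T coeff_word exists_word prod_coeff_ne_zero
   top_eq mem_cover card_cover_le cross_empty_of_union_subset support_filter_sum_subset_one)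

noncomputable section

section Rigidity

variable {m : ℕ}

/-- **Step** of the rigidity induction, `f`-side: a one-letter demotion of `f` key-above `e` is a one-letter demotion of `g`
(same point, same coefficient ratio), provided all one-letter demotions of `g` key-above it are known to be one-letter
demotions of `f`. -/
theorem step_three (l : (Fin 2 → ℝ) →L[ℝ] ℝ) (f g : Fin m → MvPolynomial (Fin 2) ℂ) (T T' : Fin m → (Fin 2 →₀ ℕ))
    (hT : ∀ j, T j ∈ (f j).support) (hTmax : ∀ j, ∀ x ∈ (f j).support, lexKey l x ≤ lexKey l (T j))
    (hT' : ∀ j, T' j ∈ (g j).support) (hTmax' : ∀ j, ∀ x ∈ (g j).support, lexKey l x ≤ lexKey l (T' j))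
    (hinjf : ∀ a b : Fin m → (Fin 2 →₀ ℕ), (∀ j, a j ∈ (f j).support) → (∀ j, b j ∈ (f j).support) →
      ∑ j, a j = ∑ j, b j → a = b)
    (hinjg : ∀ a b : Fin m → (Fin 2 →₀ ℕ), (∀ j, a j ∈ (g j).support) → (∀ j, b j ∈ (g j).support) →
      ∑ j, a j = ∑ j, b j → a = b)
    (hparf : ∀ (a : Fin m → (Fin 2 →₀ ℕ)) (p : Fin m) (x y : Fin 2 →₀ ℕ), (∀ j, a j ∈ (f j).support) →
      x ∈ (f p).support → y ∈ (f p).support → x ≠ y → x ≠ T p → y ≠ T p →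
      (∑ j, a j) + T p + T p ≠ (∑ j, T j) + x + y)
    (e : Fin 2 →₀ ℕ)
    (hzero : ∀ x : Fin 2 →₀ ℕ, x ≠ e → l (emb e) ≤ l (emb x) → coeff x (∏ j, f j) + coeff x (∏ j, g j) = 0)
    (htop : ∑ j, T j = ∑ j, T' j) (hTe : lexKey l e < lexKey l (∑ j, T j))
    {j : Fin m} {x : Fin 2 →₀ ℕ} (hx : x ∈ (f j).support) (hxT : x ≠ T j)
    (hex : lexKey l e < lexKey l (∑ i, Function.update T j x i))
    (IH : ∀ (i : Fin m) (y : Fin 2 →₀ ℕ), y ∈ (g i).support → y ≠ T' i →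
      lexKey l (∑ k, Function.update T j x k) < lexKey l (∑ k, Function.update T' i y k) →
      ∃ (j₂ : Fin m) (x₂ : Fin 2 →₀ ℕ), x₂ ∈ (f j₂).support ∧ x₂ ≠ T j₂ ∧
        ∑ k, Function.update T' i y k = ∑ k, Function.update T j₂ x₂ k) :
    ∃ (i : Fin m) (y : Fin 2 →₀ ℕ), y ∈ (g i).support ∧ y ≠ T' i ∧
      ∑ k, Function.update T j x k = ∑ k, Function.update T' i y k ∧
      coeff x (f j) / coeff (T j) (f j) = coeff y (g i) / coeff (T' i) (g i) := by
  set x₀ := ∑ k, Function.update T j x k with hx₀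
  have hx₀e : x₀ ≠ e := fun h => by rw [h] at hex; exact lt_irrefl _ hex
  have hz := hzero _ hx₀e (apply_le_of_lexKey_le l hex.le)
  have hcA0 : ∏ k, coeff (T k) (f k) ≠ 0 := prod_coeff_ne_zero f _ hT
  have hcfx : coeff x₀ (∏ k, f k) = (∏ k, coeff (T k) (f k)) * (coeff x (f j) / coeff (T j) (f j)) := by
    rw [hx₀, coeff_word f hinjf _ (update_mem' f T hT hx), prod_coeff_ratio f T hT]
    congr 1
    have : (Finset.univ.filter fun i => Function.update T j x i ≠ T i) = {j} := by
      ext i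
      rw [Finset.mem_filter, Finset.mem_singleton]
      rcases eq_or_ne i j with rfl | hne
      · rw [Function.update_self]; exact ⟨fun _ => rfl, fun _ => ⟨Finset.mem_univ _, hxT⟩⟩
      · rw [Function.update_of_ne hne]; exact ⟨fun h => absurd rfl h.2, fun h => absurd h hne⟩
    rw [this, Finset.prod_singleton, Function.update_self]
  have hρ : coeff x (f j) / coeff (T j) (f j) ≠ 0 := div_ne_zero (mem_support_iff.1 hx) (mem_support_iff.1 (hT j))
  have hxg : x₀ ∈ (∏ k, g k).support := by
    rw [mem_support_iff]; intro h; rw [h, add_zero, hcfx] at hz; exact (mul_ne_zero hcA0 hρ) hz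
  obtain ⟨a', ha', hsum⟩ := exists_word g hinjg hxg
  have hlt_top : lexKey l x₀ < lexKey l (∑ k, T k) :=
    lexKey_sum_lt_promote l f T hTmax (update_mem' f T hT hx) (fun k => Or.inr rfl)
      ⟨j, rfl, by rw [Function.update_self]; exact hxT⟩
  set D := Finset.univ.filter fun i => a' i ≠ T' i with hD
  by_cases hD0 : D = ∅
  · have ha'T : a' = T' := funext fun i => eq_T_of_not_mem_filter T' (by rw [← hD, hD0]; exact Finset.notMem_empty i)
    rw [ha'T, ← htop] at hsum
    rw [hsum] at hlt_top
    exact absurd hlt_top (lt_irrefl _)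
  obtain ⟨i, hi⟩ := Finset.nonempty_iff_ne_empty.2 hD0
  have hi' : a' i ≠ T' i := ne_T_of_mem_filter T' hi
  by_cases hD1 : ∀ i₁ ∈ D, i₁ = i
  · -- one demoted letter: matched
    have ha'eq : a' = Function.update T' i (a' i) := by
      funext i₁
      rcases eq_or_ne i₁ i with rfl | hne
      · rw [Function.update_self]
      · rw [Function.update_of_ne hne]; exact eq_T_of_not_mem_filter T' (fun h => hne (hD1 i₁ h))
    refine ⟨i, a' i, ha' i, hi', by rw [← hsum]; exact congrArg _ (funext fun k => by rw [← ha'eq]), ?_⟩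
    have hcgx : coeff x₀ (∏ k, g k) = (∏ k, coeff (T' k) (g k)) * (coeff (a' i) (g i) / coeff (T' i) (g i)) := by
      rw [← hsum, coeff_word g hinjg _ ha', prod_coeff_ratio g T' hT' a']
      congr 1
      have : (Finset.univ.filter fun k => a' k ≠ T' k) = {i} := by
        ext k; rw [Finset.mem_singleton]
        exact ⟨fun h => hD1 k h, fun h => by rw [h]; exact hi⟩
      rw [this, Finset.prod_singleton]
    have hne : (∑ k, T k) ≠ e := fun h => by rw [h] at hTe; exact lt_irrefl _ hTe
    have hTc := hzero _ hne (apply_le_of_lexKey_le l hTe.le)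
    rw [coeff_word f hinjf _ hT] at hTc
    rw [htop, coeff_word g hinjg _ hT'] at hTc
    rw [hcfx, hcgx] at hz
    have hcB : ∏ k, coeff (T' k) (g k) = -∏ k, coeff (T k) (f k) := eq_neg_of_add_eq_zero_right hTc
    rw [hcB, neg_mul, ← sub_eq_add_neg, ← mul_sub, mul_eq_zero, sub_eq_zero] at hz
    exact hz.resolve_left hcA0
  · -- at least two demoted letters: all matched into `f`; injective ⇒ dissociation, else a double match
    push Not at hD1
    obtain ⟨i', hi'D, hne⟩ := hD1
    have hkey : ∀ i₀ ∈ D, lexKey l x₀ < lexKey l (∑ k, Function.update T' i₀ (a' i₀) k) := by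
      intro i₀ hi₀
      rw [← hsum]
      refine lexKey_sum_lt_promote l g T' hTmax' ha' (fun k => ?_) ?_
      · rcases eq_or_ne k i₀ with rfl | hk
        · left; rw [Function.update_self]
        · right; rw [Function.update_of_ne hk]
      · by_cases h : i₀ = i
        · subst h; exact ⟨i', by rw [Function.update_of_ne hne], ne_T_of_mem_filter T' hi'D⟩
        · exact ⟨i, by rw [Function.update_of_ne (Ne.symm h)], hi'⟩
    have hIH' : ∀ i₀ ∈ D, ∃ (j₂ : Fin m) (x₂ : Fin 2 →₀ ℕ), x₂ ∈ (f j₂).support ∧ x₂ ≠ T j₂ ∧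
        ∑ k, Function.update T' i₀ (a' i₀) k = ∑ k, Function.update T j₂ x₂ k := fun i₀ hi₀ =>
      IH i₀ (a' i₀) (ha' i₀) (ne_T_of_mem_filter T' hi₀) (hkey i₀ hi₀)
    haveI : Nonempty (Fin m) := ⟨i⟩
    choose! jj xx hxx hxxT hsums using hIH'
    have hgap : ∀ i₀ ∈ D, emb (T' i₀) - emb (a' i₀) = emb (T (jj i₀)) - emb (xx i₀) := by
      intro i₀ hi₀
      have h1 := emb_sum_update T' i₀ (a' i₀)
      have h2 := emb_sum_update T (jj i₀) (xx i₀)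
      rw [hsums i₀ hi₀, h2, htop] at h1
      exact (sub_right_inj.1 h1).symm
    by_cases hinjD : Set.InjOn jj D
    · -- injective: `x₀` is a second word of `f`
      obtain ⟨b, hbmem, hbD, hbsum, -⟩ := transfer_letters f T' T hT a' D jj xx
        (fun i₀ hi₀ => ⟨hxx i₀ hi₀, hxxT i₀ hi₀, hgap i₀ hi₀⟩) hinjD
      have hbx : ∑ k, b k = x₀ := by
        apply emb_injective
        rw [hbsum, ← sum_gap_eq_sum_filter T' a', htop, ← emb_sum_eq T' a', hsum]
      have hbw := hinjf _ _ hbmem (update_mem' f T hT hx) (by rw [hbx])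
      subst hbw
      have himg : D.image jj = {j} := by
        rw [← hbD]
        ext k
        rw [Finset.mem_filter, Finset.mem_singleton]
        rcases eq_or_ne k j with rfl | hk
        · rw [Function.update_self]; exact ⟨fun _ => rfl, fun _ => ⟨Finset.mem_univ _, hxT⟩⟩
        · rw [Function.update_of_ne hk]; exact ⟨fun h => absurd rfl h.2, fun h => absurd h hk⟩
      have hcard := Finset.card_image_of_injOn hinjD
      rw [himg, Finset.card_singleton] at hcard
      have h2 : 1 < D.card := Finset.one_lt_card.2 ⟨i', hi'D, i, hi, hne⟩
      omega
    · -- not injective: a double match, excluded by `no_double_match`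
      rw [Set.InjOn] at hinjD
      push Not at hinjD
      obtain ⟨i₁, hi₁, i₂, hi₂, hjj, hi₁₂⟩ := hinjD
      have hxne : xx i₁ ≠ xx i₂ := by
        intro hxeq
        have hs : ∑ k, Function.update T' i₁ (a' i₁) k = ∑ k, Function.update T' i₂ (a' i₂) k := by
          rw [hsums i₁ hi₁, hsums i₂ hi₂, hjj, hxeq]
        exact hi₁₂ (update_sum_inj g T' hT' hinjg (ha' i₁) (ne_T_of_mem_filter T' hi₁) (ha' i₂) hs).1
      refine (no_double_match l f g T T' hT' hinjf hinjg hparf e hzero htop hi₁₂ (ha' i₁) (ha' i₂) (hxx i₁ hi₁) (by rw [hjj]; exact hxx i₂ hi₂)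
        hxne (hxxT i₁ hi₁) (by rw [hjj]; exact hxxT i₂ hi₂) (hgap i₁ hi₁) (by rw [hjj]; exact hgap i₂ hi₂) ?_).elim
      -- the two-letter demotion is key-above `x₀`, hence above `e`
      refine lt_of_lt_of_le hex ?_
      rw [← hsum]
      rcases (Finset.univ.filter fun k => a' k ≠ T' k ∧ k ≠ i₁ ∧ k ≠ i₂).eq_empty_or_nonempty with h0 | ⟨i₃, hi₃⟩
      · -- `D = {i₁, i₂}`: the two-letter demotion IS `a'`
        apply le_of_eq; congr 1
        refine Finset.sum_congr rfl fun k _ => ?_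
        rcases eq_or_ne k i₂ with rfl | hk2
        · rw [Function.update_self]
        · rw [Function.update_of_ne hk2]
          rcases eq_or_ne k i₁ with rfl | hk1
          · rw [Function.update_self]
          · rw [Function.update_of_ne hk1]
            by_contra hk
            have : k ∈ (Finset.univ.filter fun k => a' k ≠ T' k ∧ k ≠ i₁ ∧ k ≠ i₂) :=
              Finset.mem_filter.2 ⟨Finset.mem_univ _, hk, hk1, hk2⟩
            rw [h0] at this; exact absurd this (Finset.notMem_empty k)
      · apply le_of_lt
        obtain ⟨-, hi₃a, hi₃1, hi₃2⟩ := Finset.mem_filter.1 hi₃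
        refine lexKey_sum_lt_promote l g T' hTmax' ha' (fun k => ?_) ⟨i₃, ?_, hi₃a⟩
        · rcases eq_or_ne k i₂ with rfl | hk2
          · left; rw [Function.update_self]
          · rw [Function.update_of_ne hk2]
            rcases eq_or_ne k i₁ with rfl | hk1
            · left; rw [Function.update_self]
            · right; rw [Function.update_of_ne hk1]
        · rw [Function.update_of_ne hi₃2, Function.update_of_ne hi₃1]

/-- **Rigidity for trinomial frames without parallelogram coincidences.**  Every one-letter demotion point of either frame
key-above `e` is matched: a one-letter demotion point of BOTH frames with equal coefficient ratios. -/
theorem matched_three (l : (Fin 2 → ℝ) →L[ℝ] ℝ) (f g : Fin m → MvPolynomial (Fin 2) ℂ) (T T' : Fin m → (Fin 2 →₀ ℕ))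
    (hT : ∀ j, T j ∈ (f j).support) (hTmax : ∀ j, ∀ x ∈ (f j).support, lexKey l x ≤ lexKey l (T j))
    (hT' : ∀ j, T' j ∈ (g j).support) (hTmax' : ∀ j, ∀ x ∈ (g j).support, lexKey l x ≤ lexKey l (T' j))
    (hinjf : ∀ a b : Fin m → (Fin 2 →₀ ℕ), (∀ j, a j ∈ (f j).support) → (∀ j, b j ∈ (f j).support) →
      ∑ j, a j = ∑ j, b j → a = b)
    (hinjg : ∀ a b : Fin m → (Fin 2 →₀ ℕ), (∀ j, a j ∈ (g j).support) → (∀ j, b j ∈ (g j).support) →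
      ∑ j, a j = ∑ j, b j → a = b)
    (hparf : ∀ (a : Fin m → (Fin 2 →₀ ℕ)) (p : Fin m) (x y : Fin 2 →₀ ℕ), (∀ j, a j ∈ (f j).support) →
      x ∈ (f p).support → y ∈ (f p).support → x ≠ y → x ≠ T p → y ≠ T p →
      (∑ j, a j) + T p + T p ≠ (∑ j, T j) + x + y)
    (hparg : ∀ (a : Fin m → (Fin 2 →₀ ℕ)) (p : Fin m) (x y : Fin 2 →₀ ℕ), (∀ j, a j ∈ (g j).support) →
      x ∈ (g p).support → y ∈ (g p).support → x ≠ y → x ≠ T' p → y ≠ T' p →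
      (∑ j, a j) + T' p + T' p ≠ (∑ j, T' j) + x + y)
    (e : Fin 2 →₀ ℕ)
    (hzero : ∀ x : Fin 2 →₀ ℕ, x ≠ e → l (emb e) ≤ l (emb x) → coeff x (∏ j, f j) + coeff x (∏ j, g j) = 0)
    (htop : ∑ j, T j = ∑ j, T' j) (hTe : lexKey l e < lexKey l (∑ j, T j))
    (z : Fin 2 →₀ ℕ) (hez : lexKey l e < lexKey l z)
    (hz : ((∃ (j : Fin m) (xl : Fin 2 →₀ ℕ), xl ∈ (f j).support ∧ xl ≠ T j ∧ z = ∑ k, Function.update T j xl k) ∨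
        (∃ (i : Fin m) (y : Fin 2 →₀ ℕ), y ∈ (g i).support ∧ y ≠ T' i ∧ z = ∑ k, Function.update T' i y k))) :
    ∃ (j : Fin m) (xl : Fin 2 →₀ ℕ) (i : Fin m) (y : Fin 2 →₀ ℕ), xl ∈ (f j).support ∧ xl ≠ T j ∧
        y ∈ (g i).support ∧ y ≠ T' i ∧ z = ∑ k, Function.update T j xl k ∧ z = ∑ k, Function.update T' i y k ∧
        coeff xl (f j) / coeff (T j) (f j) = coeff y (g i) / coeff (T' i) (g i) := by
  -- candidate points and the bad ones among them
  set Pts : Finset (Fin 2 →₀ ℕ) :=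
    (Finset.univ.biUnion fun j => ((f j).support).image fun xl => ∑ k, Function.update T j xl k) ∪
    (Finset.univ.biUnion fun i => ((g i).support).image fun y => ∑ k, Function.update T' i y k) with hPts
  set Bad : Finset (Fin 2 →₀ ℕ) := Pts.filter fun z => lexKey l e < lexKey l z ∧ ((∃ (j : Fin m) (xl : Fin 2 →₀ ℕ), xl ∈ (f j).support ∧ xl ≠ T j ∧ z = ∑ k, Function.update T j xl k) ∨
        (∃ (i : Fin m) (y : Fin 2 →₀ ℕ), y ∈ (g i).support ∧ y ≠ T' i ∧ z = ∑ k, Function.update T' i y k)) ∧ ¬ (∃ (j : Fin m) (xl : Fin 2 →₀ ℕ) (i : Fin m) (y : Fin 2 →₀ ℕ), xl ∈ (f j).support ∧ xl ≠ T j ∧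
        y ∈ (g i).support ∧ y ≠ T' i ∧ z = ∑ k, Function.update T j xl k ∧ z = ∑ k, Function.update T' i y k ∧
        coeff xl (f j) / coeff (T j) (f j) = coeff y (g i) / coeff (T' i) (g i)) with hBad
  have hmemPts : ∀ z, ((∃ (j : Fin m) (xl : Fin 2 →₀ ℕ), xl ∈ (f j).support ∧ xl ≠ T j ∧ z = ∑ k, Function.update T j xl k) ∨
        (∃ (i : Fin m) (y : Fin 2 →₀ ℕ), y ∈ (g i).support ∧ y ≠ T' i ∧ z = ∑ k, Function.update T' i y k)) → z ∈ Pts := by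
    rintro z (⟨j, xl, hxl, -, rfl⟩ | ⟨i, y, hy, -, rfl⟩)
    · exact Finset.mem_union_left _ (Finset.mem_biUnion.2 ⟨j, Finset.mem_univ _, Finset.mem_image.2 ⟨xl, hxl, rfl⟩⟩)
    · exact Finset.mem_union_right _ (Finset.mem_biUnion.2 ⟨i, Finset.mem_univ _, Finset.mem_image.2 ⟨y, hy, rfl⟩⟩)
  by_contra hnot
  have hBne : Bad.Nonempty := ⟨z, Finset.mem_filter.2 ⟨hmemPts z hz, hez, hz, hnot⟩⟩
  obtain ⟨w, hwBad, hwmax⟩ := Finset.exists_max_image Bad (lexKey l) hBne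
  obtain ⟨-, hew, hw, hwM⟩ := Finset.mem_filter.1 hwBad
  have hgood : ∀ z, lexKey l w < lexKey l z → ((∃ (j : Fin m) (xl : Fin 2 →₀ ℕ), xl ∈ (f j).support ∧ xl ≠ T j ∧ z = ∑ k, Function.update T j xl k) ∨
        (∃ (i : Fin m) (y : Fin 2 →₀ ℕ), y ∈ (g i).support ∧ y ≠ T' i ∧ z = ∑ k, Function.update T' i y k)) → ∃ (j : Fin m) (xl : Fin 2 →₀ ℕ) (i : Fin m) (y : Fin 2 →₀ ℕ), xl ∈ (f j).support ∧ xl ≠ T j ∧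
        y ∈ (g i).support ∧ y ≠ T' i ∧ z = ∑ k, Function.update T j xl k ∧ z = ∑ k, Function.update T' i y k ∧
        coeff xl (f j) / coeff (T j) (f j) = coeff y (g i) / coeff (T' i) (g i) := by
    intro z hz1 hz2
    by_contra hzM
    have hzBad : z ∈ Bad := Finset.mem_filter.2 ⟨hmemPts z hz2, lt_trans hew hz1, hz2, hzM⟩
    exact absurd (hwmax z hzBad) (not_le.2 hz1)
  apply hwM
  have hzero' : ∀ x : Fin 2 →₀ ℕ, x ≠ e → l (emb e) ≤ l (emb x) →
      coeff x (∏ j, g j) + coeff x (∏ j, f j) = 0 := fun x hx hle => by rw [add_comm]; exact hzero x hx hle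
  have hTe' : lexKey l e < lexKey l (∑ j, T' j) := htop ▸ hTe
  rcases hw with ⟨j, xl, hxl, hxlT, hwj⟩ | ⟨i, y, hy, hyT, hwi⟩
  · have IH : ∀ (i : Fin m) (y : Fin 2 →₀ ℕ), y ∈ (g i).support → y ≠ T' i →
        lexKey l (∑ k, Function.update T j xl k) < lexKey l (∑ k, Function.update T' i y k) →
        ∃ (j₂ : Fin m) (x₂ : Fin 2 →₀ ℕ), x₂ ∈ (f j₂).support ∧ x₂ ≠ T j₂ ∧
          ∑ k, Function.update T' i y k = ∑ k, Function.update T j₂ x₂ k := by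
      intro i y hy hyT hlt
      rw [← hwj] at hlt
      obtain ⟨j₂, x₂, i₂, y₂, hx₂, hx₂T, -, -, h1, -, -⟩ := hgood _ hlt (Or.inr ⟨i, y, hy, hyT, rfl⟩)
      exact ⟨j₂, x₂, hx₂, hx₂T, h1⟩
    rw [hwj] at hew
    obtain ⟨i, y, hy, hyT, hsum, hρ⟩ := step_three l f g T T' hT hTmax hT' hTmax' hinjf hinjg hparf e hzero htop hTe
      hxl hxlT hew IH
    exact ⟨j, xl, i, y, hxl, hxlT, hy, hyT, hwj, hwj.trans hsum, hρ⟩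
  · have IH : ∀ (j : Fin m) (xl : Fin 2 →₀ ℕ), xl ∈ (f j).support → xl ≠ T j →
        lexKey l (∑ k, Function.update T' i y k) < lexKey l (∑ k, Function.update T j xl k) →
        ∃ (i₂ : Fin m) (y₂ : Fin 2 →₀ ℕ), y₂ ∈ (g i₂).support ∧ y₂ ≠ T' i₂ ∧
          ∑ k, Function.update T j xl k = ∑ k, Function.update T' i₂ y₂ k := by
      intro j xl hxl hxlT hlt
      rw [← hwi] at hlt
      obtain ⟨j₂, x₂, i₂, y₂, -, -, hy₂, hy₂T, -, h2, -⟩ := hgood _ hlt (Or.inl ⟨j, xl, hxl, hxlT, rfl⟩)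
      exact ⟨i₂, y₂, hy₂, hy₂T, h2⟩
    rw [hwi] at hew
    obtain ⟨j, xl, hxl, hxlT, hsum, hρ⟩ := step_three l g f T' T hT' hTmax' hT hTmax hinjg hinjf hparg e hzero'
      htop.symm hTe' hy hyT hew IH
    exact ⟨j, xl, i, y, hxl, hxlT, hy, hyT, hwi.trans hsum, hwi, hρ.symm⟩

end Rigidity

end

end Summit.ValiantsHypothesis.ValiantsHypothesis.Theorems.NewtonFramesTwoProducts.FrameRungTwoTrinomial
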